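import Literature.NumberTheory.Rogawski1990.EndoscopicEmbedding            -- ★ `endoForm`, `endoGL`, `endoEmb`, `mem_range_endoEmb_iff_apply`, `isClosedEmbedding_endoEmb`
import Literature.NumberTheory.Automorphic.ArchLocalRegularCentralizer     -- ★ p837004: `apply_eq_zero_of_diagonal_mul_eq_mul_diagonal`; ★ D1′b `circleDiagonal`
import HarnessLib

/-!
# The centraliser of a SPLIT-SINGULAR torus point of `U(σ_w diag α)(ℂ)` is the endoscopic block group `U(σ_w diag(α₀,α₂))(ℂ) × U(σ_w α₁)(ℂ)`
# (road D2′ gap (V9); Rogawski 1990 §8.2 p. 122 «`γ₀ = γ(θ,φ,0)` … whose centralizer is `H`», §4.8 Case (a), §4.9 p. 55)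

Topic `NumberTheory/Automorphic`; namespaces `Literature.NumberTheory.Automorphic` (§1, generic) and `….UnitaryGroup` (§2, at a complex place).  THEOREMS ONLY
(no `def`, no instance, no notation, no axiom, no `sorry`).  Cell `pub/hodgecm-mathlib`, ENGINE T1 (crux H413 = `stmt-HodgeConjecture-24833`); floor-1 preparation,
count-neutral, under books rows #88 (ST-∞) ∕ #111 (S-d) (F0P3a-p02 (g8)'s CENSUS-D2prime-HClimit §4 gap (V9) «centraliser models `Z(γ₀) ≃ₜ* U(1,1)×U(1)` resp. `U(2)×U(1)`»;
LEAD DESK WORD T6-93 (2) (c)); author F0P3a-p06 (g9).  Built ENTIRELY over ★ `Rogawski1990/EndoscopicEmbedding` (`endoForm`, `endoGL`, `endoEmb`,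
`mem_range_endoEmb_iff_apply`, `endoEmb_injective`, `isClosedEmbedding_endoEmb`), ★ `ArchLocalRegularCentralizer` (p837004: `apply_eq_zero_of_diagonal_mul_eq_mul_diagonal`)
and ★ D1′b `ArchDiagonalTorus` (`circleDiagonal`).

WHY.  In the limit formulas of §8.2 the regular torus point `γ(θ, φ, ψ)` (eigenvalues `e^{i(θ+ψ)}, e^{iφ}, e^{i(θ−ψ)}`) degenerates at `ψ = 0` to the SPLIT-SINGULAR
`γ₀ = diag(e^{iθ}, e^{iφ}, e^{iθ})`, whose equal eigenvalue pair sits at `{e₁, e₃}` — EXACTLY the tree's endoscopic pattern `(* 0 *; 0 * 0; * 0 *)` (★ `endoPerm`).  The rank-one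
limit formula is applied INSIDE the centraliser `H = Z(γ₀)`, where `γ₀` is central; this file identifies `Z(γ₀)` with the block group, as a subgroup and as a topological group.
* §1 (generic commutative ring `S`, any `σ`, forms with `endoForm J₂ J₁ = J₃`): `endoForm_diagonal` (`endoForm (diag(α₀,α₂)) (α₁) = diag α`) and `endoForm_diagonal_map`;
  `offPattern_eq_zero_of_commute_diagonal` ∕ `commute_diagonal_of_offPattern_eq_zero` (a matrix commutes with `diag(d₀, d₁, d₀)`, `d₀ − d₁` a unit, iff its four off-pattern
  entries vanish); **`centralizer_eq_range_endoEmb_of_coe_eq_diagonal`** — for `γ₀ ∈ U(σ, J₃)` with matrix `diag(d₀, d₁, d₀)`, `Z(γ₀) = range (endoEmb σ J₂ J₁ J₃ h)`.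
* §2 (a complex place `w` of `L`, `G_w = U(σ_w diag α)(ℂ)` written `unitaryGroupOfForm (starRingEnd ℂ) (σ_w diag α)` = ★ `archLocal L 3 (diagonal α) w` by `rfl`):
  `endoForm_archLocal_diagonal` (the pattern identity `h` for `ι_w`), **`centralizer_circleDiagonal_eq_range_endoEmb`** (`z₀ = z₂ ≠ z₁` ⇒ `Z_{G_w}(diag z) = range ι_w`),
  `circleDiagonal_blocks_mem`, **`circleDiagonal_eq_endoEmb`** (`diag z = ι_w(diag(z₀,z₂), (z₁))` — `γ₀` is CENTRAL in `H_w`), `endoEmb_mem_centralizer_circleDiagonal`,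
  **`exists_centralizer_continuousMulEquiv_of_splitSingular`** (`Z_{G_w}(γ₀) ≃ₜ* U(σ_w diag(α₀,α₂))(ℂ) × U(σ_w α₁)(ℂ)` with inverse `ι_w` on the nose).
SCOPE.  The coincidence pattern is `{e₁,e₃} ∕ {e₂}` (print's and the tree's); the patterns `{e₁,e₂}`, `{e₂,e₃}` reduce to it by relabelling `α ↦ α ∘ σ` (not done here).  In `U(2,1)`
the block group is `U(1,1) × U(1)` or the COMPACT `U(2) × U(1)` according to the signs of `σ_w α₀, σ_w α₂` — both are instances of §2 (Kottwitz signs `e(γ₀) = 1`, `e(γ₀′) = −1`,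
★ `kottwitzSign`).  HONEST LABEL: HC_CM is proved only modulo the printed citations until rung 0 closes; this file is linear algebra ∕ topology and pays nothing by itself.

## References
* [Rogawski1990] J. D. Rogawski, *Automorphic Representations of Unitary Groups in Three Variables*, Ann. of Math. Stud. 123 (1990): §4.8 Case (a) p. 53 (the block subgroup
  `(* 0 *; 0 * 0; * 0 *)`), §4.9 p. 55 («`γ ∈ H` … of the form `(* 0 *; 0 γ₂ 0; * 0 *)`»), §8.2 pp. 122–123 (`γ₀`, `Z(γ₀) = H`, `e(γ₀) = 1, e(γ₀′) = −1`).
* [PlatonovRapinchuk1994] V. Platonov, A. Rapinchuk, *Algebraic Groups and Number Theory* (1994), §2.3 (unitary groups of hermitian forms, block subgroups).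
-/

set_option autoImplicit false

noncomputable section

open Matrix NumberField NumberField.InfinitePlace Topology
open Literature.NumberTheory.Rogawski1990
open scoped MatrixGroups ComplexConjugate

namespace Literature.NumberTheory.Automorphic

/-! ## §1 Generic (any commutative ring `S`, any `σ`): the diagonal pattern form and the centraliser of a split-singular diagonal element -/

section Generic

variable {S : Type*} [CommRing S]

/-- `endoForm (diag(α₀, α₂)) (α₁) = diag(α₀, α₁, α₂)`: the `{e₁,e₃} ∕ {e₂}` pattern form of a DIAGONAL form is the diagonal form (★ `endoForm_eq`).
[cite: Rogawski1990, §4.8 Case (a) p. 53] -/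
theorem endoForm_diagonal (α : Fin 3 → S) :
    endoForm (Matrix.diagonal ![α 0, α 2]) (Matrix.diagonal ![α 1]) = Matrix.diagonal α := by
  rw [endoForm_eq]
  ext i j; fin_cases i <;> fin_cases j <;> rfl

/-- The same after an entrywise ring homomorphism (e.g. `σ_w : L → ℂ`). [cite: Rogawski1990, §4.8 Case (a) p. 53] -/
theorem endoForm_diagonal_map {S' : Type*} [CommRing S'] (f : S →+* S') (α : Fin 3 → S) :
    endoForm ((Matrix.diagonal ![α 0, α 2]).map f) ((Matrix.diagonal ![α 1]).map f) = (Matrix.diagonal α).map f := by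
  rw [← endoForm_map, endoForm_diagonal]

/-- **A matrix commuting with a SPLIT-SINGULAR diagonal matrix `diag(d₀, d₁, d₀)` (`d₀ − d₁` a unit) has the endoscopic pattern `(* 0 *; 0 * 0; * 0 *)`**:
its four off-pattern entries vanish (★ `apply_eq_zero_of_diagonal_mul_eq_mul_diagonal`). [cite: Rogawski1990, §4.9 p. 55; §8.2 p. 122] -/
theorem offPattern_eq_zero_of_commute_diagonal {d : Fin 3 → S} (h02 : d 0 = d 2) (h01 : IsUnit (d 0 - d 1)) {A : Matrix (Fin 3) (Fin 3) S}
    (h : Matrix.diagonal d * A = A * Matrix.diagonal d) : A 0 1 = 0 ∧ A 1 0 = 0 ∧ A 1 2 = 0 ∧ A 2 1 = 0 := by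
  have h10 : IsUnit (d 1 - d 0) := by rw [← neg_sub]; exact h01.neg
  have h12 : IsUnit (d 1 - d 2) := by rw [← h02]; exact h10
  have h21 : IsUnit (d 2 - d 1) := by rw [← h02]; exact h01
  exact ⟨Literature.LinearAlgebra.Matrix.apply_eq_zero_of_diagonal_mul_eq_mul_diagonal h h01,
    Literature.LinearAlgebra.Matrix.apply_eq_zero_of_diagonal_mul_eq_mul_diagonal h h10,
    Literature.LinearAlgebra.Matrix.apply_eq_zero_of_diagonal_mul_eq_mul_diagonal h h12,
    Literature.LinearAlgebra.Matrix.apply_eq_zero_of_diagonal_mul_eq_mul_diagonal h h21⟩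

/-- Conversely, a matrix of the pattern `(* 0 *; 0 * 0; * 0 *)` commutes with `diag(d₀, d₁, d₀)`. [cite: Rogawski1990, §4.9 p. 55] -/
theorem commute_diagonal_of_offPattern_eq_zero {d : Fin 3 → S} (h02 : d 0 = d 2) {A : Matrix (Fin 3) (Fin 3) S}
    (h : A 0 1 = 0 ∧ A 1 0 = 0 ∧ A 1 2 = 0 ∧ A 2 1 = 0) : Matrix.diagonal d * A = A * Matrix.diagonal d := by
  obtain ⟨h01, h10, h12, h21⟩ := h
  ext i j
  rw [Matrix.diagonal_mul, Matrix.mul_diagonal]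
  fin_cases i <;> fin_cases j <;> simp [h01, h10, h12, h21, h02, mul_comm]

variable (σ : S →+* S) {J₂ : Matrix (Fin 2) (Fin 2) S} {J₁ : Matrix (Fin 1) (Fin 1) S} {J₃ : Matrix (Fin 3) (Fin 3) S}

/-- **THE CENTRALISER OF A SPLIT-SINGULAR DIAGONAL ELEMENT OF `U(σ, J₃)` IS THE ENDOSCOPIC BLOCK GROUP `ι(U(σ, J₂) × U(σ, J₁))`** (generic ring and forms with
`endoForm J₂ J₁ = J₃`): for `γ₀ ∈ U(σ, J₃)` with matrix `diag(d₀, d₁, d₀)`, `d₀ − d₁` a unit, `Z(γ₀) = range ι` (★ `mem_range_endoEmb_iff_apply`).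
[cite: Rogawski1990, §4.9 p. 55; §8.2 p. 122] [cite: PlatonovRapinchuk1994, §2.3] -/
theorem centralizer_eq_range_endoEmb_of_coe_eq_diagonal (h : endoForm J₂ J₁ = J₃) {γ₀ : unitaryGroupOfForm σ J₃} {d : Fin 3 → S}
    (hγ : ((γ₀ : GL (Fin 3) S) : Matrix (Fin 3) (Fin 3) S) = Matrix.diagonal d) (h02 : d 0 = d 2) (h01 : IsUnit (d 0 - d 1)) :
    Subgroup.centralizer ({γ₀} : Set (unitaryGroupOfForm σ J₃)) = (endoEmb σ J₂ J₁ J₃ h).range := by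
  ext u
  rw [Subgroup.mem_centralizer_singleton_iff, MonoidHom.mem_range, ← Set.mem_range, mem_range_endoEmb_iff_apply]
  have key : u * γ₀ = γ₀ * u ↔
      Matrix.diagonal d * ((u : GL (Fin 3) S) : Matrix (Fin 3) (Fin 3) S) = ((u : GL (Fin 3) S) : Matrix (Fin 3) (Fin 3) S) * Matrix.diagonal d := by
    rw [← hγ]
    constructor
    · intro hu
      have := congrArg (fun k : unitaryGroupOfForm σ J₃ => ((k : GL (Fin 3) S) : Matrix (Fin 3) (Fin 3) S)) hu
      simpa only [Subgroup.coe_mul, Units.val_mul] using this.symm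
    · intro hu
      apply Subtype.ext; apply Units.ext
      simpa only [Subgroup.coe_mul, Units.val_mul] using hu.symm
  rw [key]
  exact ⟨fun hu => offPattern_eq_zero_of_commute_diagonal h02 h01 hu, fun hu => commute_diagonal_of_offPattern_eq_zero h02 hu⟩

end Generic

/-! ## §2 At a complex place `w`: `Z_{G_w}(diag(z₀, z₁, z₀)) = U(σ_w diag(α₀,α₂))(ℂ) × U(σ_w α₁)(ℂ)` inside `G_w = U(σ_w diag α)(ℂ)`

Throughout, `G_w` is written `unitaryGroupOfForm (starRingEnd ℂ) ((Matrix.diagonal α).map w.1.embedding)`, which IS ★ `archLocal L 3 (Matrix.diagonal α) w` by `rfl`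
(and likewise for the two blocks); the spelling is kept uniform with ★ `endoEmb`'s so that all statements rewrite syntactically. -/

namespace UnitaryGroup

section Place

variable (L : Type) [Field L] (α : Fin 3 → L) (w : {w : InfinitePlace L // IsComplex w})

/-- The pattern identity at the place `w`: `endoForm (σ_w diag(α₀,α₂)) (σ_w α₁) = σ_w diag α` — the hypothesis `h` of ★ `endoEmb` for the block embedding
`ι_w : archLocal L 2 (diag(α₀,α₂)) w × archLocal L 1 (α₁) w →* archLocal L 3 (diag α) w` (★ `archLocal L N H w` IS `unitaryGroupOfForm (starRingEnd ℂ) (σ_w H)`).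
[cite: Rogawski1990, §4.8 Case (a) p. 53] -/
theorem endoForm_archLocal_diagonal :
    endoForm ((Matrix.diagonal ![α 0, α 2]).map w.1.embedding) ((Matrix.diagonal ![α 1]).map w.1.embedding) =
      (Matrix.diagonal α).map w.1.embedding :=
  endoForm_diagonal_map _ α

/-- **(V9) THE CENTRALISER MODEL AT A SPLIT-SINGULAR TORUS POINT**: for `z ∈ (S¹)³` with `z₀ = z₂ ≠ z₁`, the centraliser in `G_w = U(σ_w diag α)(ℂ)` of the torus point
`γ₀ = diag(z)` is the RANGE of the endoscopic block embedding `ι_w` of `H_w = U(σ_w diag(α₀,α₂))(ℂ) × U(σ_w α₁)(ℂ)` (print: «`γ₀ = γ(θ,φ,0)` … whose centralizer is `H`»;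
in `U(2,1)` this is `U(1,1) × U(1)` or the compact `U(2) × U(1)` according to the signs of `σ_w α₀, σ_w α₂`). [cite: Rogawski1990, §8.2 p. 122; §4.9 p. 55] -/
theorem centralizer_circleDiagonal_eq_range_endoEmb {z : Fin 3 → Circle} (h02 : z 0 = z 2) (h01 : z 0 ≠ z 1) :
    Subgroup.centralizer ({(⟨circleDiagonal 3 z, circleDiagonal_mem_archLocal_diagonal L 3 α w z⟩ : unitaryGroupOfForm (starRingEnd ℂ) ((Matrix.diagonal α).map w.1.embedding))} : Set (unitaryGroupOfForm (starRingEnd ℂ) ((Matrix.diagonal α).map w.1.embedding))) =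
      MonoidHom.range (endoEmb (starRingEnd ℂ) ((Matrix.diagonal ![α 0, α 2]).map w.1.embedding) ((Matrix.diagonal ![α 1]).map w.1.embedding)
          ((Matrix.diagonal α).map w.1.embedding) (endoForm_archLocal_diagonal L α w)) :=
  centralizer_eq_range_endoEmb_of_coe_eq_diagonal (starRingEnd ℂ) (endoForm_archLocal_diagonal L α w) (coe_circleDiagonal 3 z)
    (congrArg (fun c : Circle => (c : ℂ)) h02) (isUnit_iff_ne_zero.mpr (sub_ne_zero.mpr fun e => h01 (Circle.ext e)))

/-- `diag(z₀, z₂) ∈ U(σ_w diag(α₀, α₂))(ℂ)` and `(z₁) ∈ U(σ_w α₁)(ℂ)` — the blocks of `γ₀`. [cite: Rogawski1990, §8.2 p. 122] -/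
theorem circleDiagonal_blocks_mem (z : Fin 3 → Circle) :
    circleDiagonal 2 ![z 0, z 2] ∈ unitaryGroupOfForm (starRingEnd ℂ) ((Matrix.diagonal ![α 0, α 2]).map w.1.embedding) ∧ circleDiagonal 1 ![z 1] ∈ unitaryGroupOfForm (starRingEnd ℂ) ((Matrix.diagonal ![α 1]).map w.1.embedding) :=
  ⟨circleDiagonal_mem_archLocal_diagonal L 2 _ w _, circleDiagonal_mem_archLocal_diagonal L 1 _ w _⟩

/-- **`γ₀` itself is `ι_w(diag(z₀, z₂), (z₁))`** — a CENTRAL element of the block group `H_w` (print: «`γ₀` central in `H`», the input of the rank-one limit formula).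
[cite: Rogawski1990, §8.2 pp. 122–123] -/
theorem circleDiagonal_eq_endoEmb (z : Fin 3 → Circle) :
    (⟨circleDiagonal 3 z, circleDiagonal_mem_archLocal_diagonal L 3 α w z⟩ : unitaryGroupOfForm (starRingEnd ℂ) ((Matrix.diagonal α).map w.1.embedding)) =
      (endoEmb (starRingEnd ℂ) ((Matrix.diagonal ![α 0, α 2]).map w.1.embedding) ((Matrix.diagonal ![α 1]).map w.1.embedding)
          ((Matrix.diagonal α).map w.1.embedding) (endoForm_archLocal_diagonal L α w))
        (⟨circleDiagonal 2 ![z 0, z 2], (circleDiagonal_blocks_mem L α w z).1⟩, ⟨circleDiagonal 1 ![z 1], (circleDiagonal_blocks_mem L α w z).2⟩) := by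
  apply Subtype.ext; apply Units.ext
  rw [coe_circleDiagonal, coe_coe_endoEmb_eq]
  ext i j; fin_cases i <;> fin_cases j <;> simp [Matrix.diagonal, coe_circleDiagonal]

/-- Every element of the block group commutes with `γ₀ = diag(z₀, z₁, z₀)` (no condition `z₀ ≠ z₁` needed for this direction).
[cite: Rogawski1990, §8.2 p. 122] -/
theorem endoEmb_mem_centralizer_circleDiagonal {z : Fin 3 → Circle} (h02 : z 0 = z 2)
    (p : unitaryGroupOfForm (starRingEnd ℂ) ((Matrix.diagonal ![α 0, α 2]).map w.1.embedding) × unitaryGroupOfForm (starRingEnd ℂ) ((Matrix.diagonal ![α 1]).map w.1.embedding)) :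
    (endoEmb (starRingEnd ℂ) ((Matrix.diagonal ![α 0, α 2]).map w.1.embedding) ((Matrix.diagonal ![α 1]).map w.1.embedding)
          ((Matrix.diagonal α).map w.1.embedding) (endoForm_archLocal_diagonal L α w)) p ∈ Subgroup.centralizer ({(⟨circleDiagonal 3 z, circleDiagonal_mem_archLocal_diagonal L 3 α w z⟩ : unitaryGroupOfForm (starRingEnd ℂ) ((Matrix.diagonal α).map w.1.embedding))} : Set (unitaryGroupOfForm (starRingEnd ℂ) ((Matrix.diagonal α).map w.1.embedding))) := by
  rw [Subgroup.mem_centralizer_singleton_iff]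
  apply Subtype.ext; apply Units.ext
  have hp := (mem_range_endoEmb_iff_apply (starRingEnd ℂ) (endoForm_archLocal_diagonal L α w) _).mp ⟨p, rfl⟩
  have hc := commute_diagonal_of_offPattern_eq_zero (d := fun i => (z i : ℂ)) (congrArg (fun c : Circle => (c : ℂ)) h02) hp
  simpa only [Subgroup.coe_mul, Units.val_mul, coe_circleDiagonal] using hc.symm

/-- **THE TOPOLOGICAL-GROUP MODEL `Z_{G_w}(γ₀) ≃ₜ* H_w`** (`H_w = U(σ_w diag(α₀,α₂))(ℂ) × U(σ_w α₁)(ℂ)`): there is an isomorphism of topological groups whose inverse is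
the block embedding `ι_w` on the nose (★ `endoEmb_injective`, ★ `isClosedEmbedding_endoEmb`, and `centralizer_circleDiagonal_eq_range_endoEmb`).
[cite: Rogawski1990, §8.2 p. 122; §4.8 Case (a) p. 53] [cite: PlatonovRapinchuk1994, §2.3] -/
theorem exists_centralizer_continuousMulEquiv_of_splitSingular {z : Fin 3 → Circle} (h02 : z 0 = z 2) (h01 : z 0 ≠ z 1) :
    ∃ e : Subgroup.centralizer ({(⟨circleDiagonal 3 z, circleDiagonal_mem_archLocal_diagonal L 3 α w z⟩ : unitaryGroupOfForm (starRingEnd ℂ) ((Matrix.diagonal α).map w.1.embedding))} : Set (unitaryGroupOfForm (starRingEnd ℂ) ((Matrix.diagonal α).map w.1.embedding))) ≃ₜ*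
        (unitaryGroupOfForm (starRingEnd ℂ) ((Matrix.diagonal ![α 0, α 2]).map w.1.embedding) × unitaryGroupOfForm (starRingEnd ℂ) ((Matrix.diagonal ![α 1]).map w.1.embedding)),
      ∀ p, ((e.symm p : Subgroup.centralizer ({(⟨circleDiagonal 3 z, circleDiagonal_mem_archLocal_diagonal L 3 α w z⟩ : unitaryGroupOfForm (starRingEnd ℂ) ((Matrix.diagonal α).map w.1.embedding))} : Set (unitaryGroupOfForm (starRingEnd ℂ) ((Matrix.diagonal α).map w.1.embedding)))) : unitaryGroupOfForm (starRingEnd ℂ) ((Matrix.diagonal α).map w.1.embedding)) =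
        (endoEmb (starRingEnd ℂ) ((Matrix.diagonal ![α 0, α 2]).map w.1.embedding) ((Matrix.diagonal ![α 1]).map w.1.embedding)
          ((Matrix.diagonal α).map w.1.embedding) (endoForm_archLocal_diagonal L α w)) p := by
  set ι := (endoEmb (starRingEnd ℂ) ((Matrix.diagonal ![α 0, α 2]).map w.1.embedding) ((Matrix.diagonal ![α 1]).map w.1.embedding)
          ((Matrix.diagonal α).map w.1.embedding) (endoForm_archLocal_diagonal L α w)) with hι
  have hinj : Function.Injective ι := endoEmb_injective _ _
  have hce : IsClosedEmbedding ι := isClosedEmbedding_endoEmb _ _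
  -- `H_w ≃* range ι ≃* Z(γ₀)`
  let e₁ : (unitaryGroupOfForm (starRingEnd ℂ) ((Matrix.diagonal ![α 0, α 2]).map w.1.embedding) × unitaryGroupOfForm (starRingEnd ℂ) ((Matrix.diagonal ![α 1]).map w.1.embedding)) ≃* ι.range :=
    MonoidHom.ofInjective hinj
  let e₂ : ι.range ≃* Subgroup.centralizer ({(⟨circleDiagonal 3 z, circleDiagonal_mem_archLocal_diagonal L 3 α w z⟩ : unitaryGroupOfForm (starRingEnd ℂ) ((Matrix.diagonal α).map w.1.embedding))} : Set (unitaryGroupOfForm (starRingEnd ℂ) ((Matrix.diagonal α).map w.1.embedding))) :=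
    MulEquiv.subgroupCongr (centralizer_circleDiagonal_eq_range_endoEmb L α w h02 h01).symm
  have hc₁ : Continuous e₁ := hce.continuous.subtype_mk _
  have hc₁' : Continuous e₁.symm := by
    have hval : Continuous (fun x : ι.range => (x : unitaryGroupOfForm (starRingEnd ℂ) ((Matrix.diagonal α).map w.1.embedding))) := continuous_subtype_val
    have hcomp : (fun x : ι.range => (x : unitaryGroupOfForm (starRingEnd ℂ) ((Matrix.diagonal α).map w.1.embedding))) = ι ∘ e₁.symm :=
      funext fun x => (MonoidHom.apply_ofInjective_symm hinj x).symm
    rw [hcomp] at hval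
    exact hce.isEmbedding.continuous_iff.mpr hval
  have hc₂ : Continuous e₂ := continuous_induced_rng.2 continuous_subtype_val
  have hc₂' : Continuous e₂.symm := continuous_induced_rng.2 continuous_subtype_val
  exact ⟨{ (e₁.trans e₂).symm with continuous_toFun := hc₁'.comp hc₂', continuous_invFun := hc₂.comp hc₁ }, fun p => rfl⟩

end Place

end UnitaryGroup

end Literature.NumberTheory.Automorphic
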